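import Mathlib.Logic.Equiv.Fin.Basic
import Literature.Computability.Cryptography.WordRAM
import HarnessLib

/-!
# The word RAM — discharged facts (uniqueness of runs, coin and oracle independence)

Proofs of named facts stated in `Literature.Computability.Cryptography.WordRAM` (kept in a
sibling file so that the statement file stays a definitions/named-facts file), and the small
amount of `StateTransition` bookkeeping they need:

* `terminal_unique`: for a partial step function `f : σ → Option σ`, two terminal states reached
  from the same start by iterating `flip bind f` coincide, and are reached after the same number
  of steps (the semantics is a function);
* `haltsWithin_unique_holds` discharges `haltsWithin_unique`, `outputsWithin_unique_holds`
  discharges `outputsWithin_unique` (the halting configuration / the output of a run is unique);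
* `step_congr_coins`: a deterministic program (no `rand`) steps identically under any two coin
  streams; `outputsWithin_iff_of_isDeterministic_holds` discharges
  `outputsWithin_iff_of_isDeterministic`;
* `step_congr_oracle`: an oracle-free program (no `query`) steps identically under any two
  oracles (`haltsWithin_iff_of_isOracleFree`, `outputsWithin_iff_of_isOracleFree`);
* `successProb_eq_one_iff_of_isDeterministic_holds` and `successProb_eq_of_isDeterministic_holds`
  discharge the two success-probability facts for deterministic programs (the event
  "output in `S` within `t` steps" does not depend on the coin vector, so its probability is the
  indicator of the zero-coin run);
* `iterate_step_congr_of_agree`, `OutputsWithin.congr_coins`, `HaltsWithin.congr_coins`: a run of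
  at most `t` steps reads only the coins at positions `< t` (`step_coinPos_le`,
  `step_congr_coinPos`); `successProb_mono_steps`: the success probability is monotone in the time
  bound (counting extensions of coin vectors, `card_filter_mul_card_pow_le`) — the randomised
  counterpart of `OutputsWithin.mono`, behind the monotonicity of `FGProblem.RandInTimeInst`.

These are the model-level ingredients of VVW ICM 2018, Prop. 2.1 (identifying the answer of an
inline, oracle-free, deterministic sub-run with the oracle it implements), see
`Literature.Computability.Cryptography.FGComplexity`.

## References

* V. Vassilevska Williams, *On some fine-grained questions in algorithms and complexity*,
  Proc. ICM 2018, §2 (word RAM, deterministic and randomised algorithms, oracle calls).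
* T. Hagerup, *Sorting and searching on the word RAM*, STACS 1998, §2 (the machine model).
-/

namespace Literature.Computability.Cryptography.WordRAM

open StateTransition

/-! ## Iterating a partial step function -/

section iterate

variable {σ : Type*} (f : σ → Option σ)

/-- `flip bind f` sends the undefined state to itself. [folklore] -/
@[simp] theorem flip_bind_none : (flip bind f : Option σ → Option σ) none = none := rfl

/-- `flip bind f` on a defined state is `f`. [folklore] -/
@[simp] theorem flip_bind_some (a : σ) : (flip bind f : Option σ → Option σ) (some a) = f a := rfl

/-- Iterating from the undefined state stays undefined. [folklore] -/
@[simp] theorem iterate_flip_bind_none (n : ℕ) : (flip bind f)^[n] (none : Option σ) = none := by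
  induction n with
  | zero => rfl
  | succ n ih => rw [Function.iterate_succ_apply, flip_bind_none, ih]

/-- Iterating a positive number of times from a terminal state gives the undefined state. [folklore] -/
theorem iterate_flip_bind_of_terminal {a : σ} (ha : f a = none) {n : ℕ} (hn : 0 < n) :
    (flip bind f)^[n] (some a) = none := by
  obtain ⟨m, rfl⟩ := Nat.exists_eq_succ_of_ne_zero hn.ne'
  rw [Function.iterate_succ_apply, flip_bind_some, ha, iterate_flip_bind_none]

/-- **Uniqueness of terminal states.** If iterating `flip bind f` from `some a` reaches the
terminal states `b` after `m` steps and `c` after `n` steps, then `m = n` and `b = c`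
(cf. `StateTransition.reaches_total`, `StateTransition.mem_eval`). [folklore] -/
theorem terminal_unique {a b c : σ} {m n : ℕ}
    (hb : (flip bind f)^[m] (some a) = some b) (hc : (flip bind f)^[n] (some a) = some c)
    (hb' : f b = none) (hc' : f c = none) : m = n ∧ b = c := by
  wlog hmn : m ≤ n generalizing b c m n
  · obtain ⟨h1, h2⟩ := this hc hb hc' hb' (le_of_not_ge hmn)
    exact ⟨h1.symm, h2.symm⟩
  obtain ⟨d, rfl⟩ := Nat.exists_eq_add_of_le hmn
  have hc2 : (flip bind f)^[d] ((flip bind f)^[m] (some a)) = some c := by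
    rw [← Function.iterate_add_apply, Nat.add_comm]; exact hc
  rw [hb] at hc2
  rcases Nat.eq_zero_or_pos d with rfl | hd
  · simp only [Function.iterate_zero, id_eq, Option.some.injEq] at hc2
    exact ⟨by simp, hc2⟩
  · rw [iterate_flip_bind_of_terminal f hb' hd] at hc2
    exact absurd hc2 (by simp)

/-- Time-bounded evaluations to terminal states from the same start agree. [folklore] -/
theorem EvalsToInTime.terminal_unique {a b c : σ} {m n : ℕ} (hb : EvalsToInTime f a (some b) m)
    (hc : EvalsToInTime f a (some c) n) (hb' : f b = none) (hc' : f c = none) : b = c :=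
  (WordRAM.terminal_unique f hb.evals_in_steps hc.evals_in_steps hb' hc').2

end iterate

/-! ## Uniqueness of runs -/

/-- Discharges `haltsWithin_unique`: the halting configuration of a run is unique. [folklore] -/
theorem haltsWithin_unique_holds : haltsWithin_unique := by
  intro P w O ρ x t t' c c' h h'
  obtain ⟨⟨e⟩, hc⟩ := h
  obtain ⟨⟨e'⟩, hc'⟩ := h'
  exact EvalsToInTime.terminal_unique (step P w O ρ) e e' hc hc'

/-- Discharges `outputsWithin_unique`: the output of a run is unique. [folklore] -/
theorem outputsWithin_unique_holds : outputsWithin_unique := by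
  intro P w O ρ x out out' t t' h h'
  rw [outputsWithin_iff_exists_haltsWithin] at h h'
  obtain ⟨c, hc, rfl⟩ := h
  obtain ⟨c', hc', rfl⟩ := h'
  rw [haltsWithin_unique_holds hc hc']

/-- The number of steps of a halting run is also unique: two time-bounded certificates for runs
of the same program on the same data reach their halting configurations after the same number
of steps. [folklore] -/
theorem HaltsWithin.steps_unique {P : Program} {w : ℕ} {O : List ℕ → List ℕ} {ρ : ℕ → ℕ}
    {x : List ℕ} {t t' : ℕ} {c c' : Cfg}
    (e : EvalsToInTime (step P w O ρ) (init w x) (some c) t)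
    (e' : EvalsToInTime (step P w O ρ) (init w x) (some c') t')
    (hc : step P w O ρ c = none) (hc' : step P w O ρ c' = none) : e.steps = e'.steps :=
  (terminal_unique (step P w O ρ) e.evals_in_steps e'.evals_in_steps hc hc').1

/-! ## Deterministic programs ignore the coins; oracle-free programs ignore the oracle -/

/-- A `rand`-free program steps identically under any two coin streams. [folklore] -/
theorem step_congr_coins {P : Program} (hP : P.IsDeterministic) (w : ℕ) (O : List ℕ → List ℕ)
    (ρ ρ' : ℕ → ℕ) (c : Cfg) : step P w O ρ c = step P w O ρ' c := by
  unfold step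
  cases c.pc with
  | none => rfl
  | some i =>
    simp only
    cases hI : P[i]? with
    | none => rfl
    | some I =>
      cases I with
      | rand dst =>
        exact absurd (hP _ (List.mem_of_getElem? hI)) (by simp [Instr.isRand])
      | _ => rfl

/-- For a deterministic program the step function does not depend on the coin stream. [folklore] -/
theorem step_eq_of_isDeterministic {P : Program} (hP : P.IsDeterministic) (w : ℕ)
    (O : List ℕ → List ℕ) (ρ ρ' : ℕ → ℕ) : step P w O ρ = step P w O ρ' :=
  funext (step_congr_coins hP w O ρ ρ')

/-- A `query`-free program steps identically under any two oracles. [folklore] -/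
theorem step_congr_oracle {P : Program} (hP : P.IsOracleFree) (w : ℕ) (O O' : List ℕ → List ℕ)
    (ρ : ℕ → ℕ) (c : Cfg) : step P w O ρ c = step P w O' ρ c := by
  unfold step
  cases c.pc with
  | none => rfl
  | some i =>
    simp only
    cases hI : P[i]? with
    | none => rfl
    | some I =>
      cases I with
      | query qa ql aa =>
        exact absurd (hP _ (List.mem_of_getElem? hI)) (by simp [Instr.isQuery])
      | _ => rfl

/-- For an oracle-free program the step function does not depend on the oracle. [folklore] -/
theorem step_eq_of_isOracleFree {P : Program} (hP : P.IsOracleFree) (w : ℕ)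
    (O O' : List ℕ → List ℕ) (ρ : ℕ → ℕ) : step P w O ρ = step P w O' ρ :=
  funext (step_congr_oracle hP w O O' ρ)

/-- Discharges `outputsWithin_iff_of_isDeterministic`: a deterministic program's runs do not
depend on the coin stream. [folklore] -/
theorem outputsWithin_iff_of_isDeterministic_holds : outputsWithin_iff_of_isDeterministic := by
  intro P hP w O ρ ρ' x out t
  simp only [OutputsWithin, step_eq_of_isDeterministic hP w O ρ ρ']

/-- A deterministic program's halting runs do not depend on the coin stream. [folklore] -/
theorem haltsWithin_iff_of_isDeterministic {P : Program} (hP : P.IsDeterministic) (w : ℕ)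
    (O : List ℕ → List ℕ) (ρ ρ' : ℕ → ℕ) (x : List ℕ) (t : ℕ) (c : Cfg) :
    HaltsWithin P w O ρ x t c ↔ HaltsWithin P w O ρ' x t c := by
  simp only [HaltsWithin, step_eq_of_isDeterministic hP w O ρ ρ']

/-- An oracle-free program's runs do not depend on the oracle. [folklore] -/
theorem outputsWithin_iff_of_isOracleFree {P : Program} (hP : P.IsOracleFree) (w : ℕ)
    (O O' : List ℕ → List ℕ) (ρ : ℕ → ℕ) (x out : List ℕ) (t : ℕ) :
    OutputsWithin P w O ρ x out t ↔ OutputsWithin P w O' ρ x out t := by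
  simp only [OutputsWithin, step_eq_of_isOracleFree hP w O O' ρ]

/-- An oracle-free program's halting runs do not depend on the oracle. [folklore] -/
theorem haltsWithin_iff_of_isOracleFree {P : Program} (hP : P.IsOracleFree) (w : ℕ)
    (O O' : List ℕ → List ℕ) (ρ : ℕ → ℕ) (x : List ℕ) (t : ℕ) (c : Cfg) :
    HaltsWithin P w O ρ x t c ↔ HaltsWithin P w O' ρ x t c := by
  simp only [HaltsWithin, step_eq_of_isOracleFree hP w O O' ρ]

/-! ## Success probability of deterministic programs -/

/-- The number of coin vectors is `(2 ^ w) ^ t`, as a real number. [folklore] -/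
theorem card_coinVectors (t w : ℕ) :
    ((Finset.univ : Finset (Fin t → Fin (2 ^ w))).card : ℝ) = ((2 : ℝ) ^ w) ^ t := by
  rw [Finset.card_univ, Fintype.card_fun, Fintype.card_fin, Fintype.card_fin]
  push_cast
  rfl

/-- Discharges `successProb_eq_one_iff_of_isDeterministic`: for a deterministic program, success
probability `1` is the same as outputting into `S` on the zero coin stream. [folklore] -/
theorem successProb_eq_one_iff_of_isDeterministic_holds :
    successProb_eq_one_iff_of_isDeterministic := by
  intro P hP w O x S t
  classical
  have key : ∀ ρ : Fin t → Fin (2 ^ w),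
      (∃ out ∈ S, OutputsWithin P w O (coinStream ρ) x out t) ↔
        ∃ out ∈ S, OutputsWithin P w O zeroCoins x out t := fun ρ => by
    simp only [outputsWithin_iff_of_isDeterministic_holds hP w O (coinStream ρ) zeroCoins]
  have hpos : (0 : ℝ) < ((2 : ℝ) ^ w) ^ t := pow_pos (pow_pos two_pos _) _
  unfold successProb
  by_cases h : ∃ out ∈ S, OutputsWithin P w O zeroCoins x out t
  · simp only [h, iff_true]
    rw [Finset.filter_true_of_mem (fun ρ _ => (key ρ).2 h), card_coinVectors]
    exact div_self hpos.ne'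
  · simp only [h, iff_false]
    rw [Finset.filter_false_of_mem (fun ρ _ => fun hρ => h ((key ρ).1 hρ))]
    simp

/-- Discharges `successProb_eq_of_isDeterministic`: for a deterministic program the success
probability is `0` or `1`. [folklore] -/
theorem successProb_eq_of_isDeterministic_holds : successProb_eq_of_isDeterministic := by
  intro P hP w O x S t
  classical
  by_cases h : ∃ out ∈ S, OutputsWithin P w O zeroCoins x out t
  · exact Or.inr ((successProb_eq_one_iff_of_isDeterministic_holds hP w O x S t).2 h)
  · left
    have key : ∀ ρ : Fin t → Fin (2 ^ w),
        ¬ ∃ out ∈ S, OutputsWithin P w O (coinStream ρ) x out t := fun ρ hρ => by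
      simp only [outputsWithin_iff_of_isDeterministic_holds hP w O (coinStream ρ) zeroCoins] at hρ
      exact h hρ
    unfold successProb
    rw [Finset.filter_false_of_mem (fun ρ _ => key ρ)]
    simp

/-- For a deterministic program, the success probability is the indicator of the event
"the zero-coin run outputs into `S` within `t` steps". [folklore] -/
theorem successProb_of_isDeterministic {P : Program} (hP : P.IsDeterministic) (w : ℕ)
    (O : List ℕ → List ℕ) (x : List ℕ) (S : Set (List ℕ)) (t : ℕ)
    [Decidable (∃ out ∈ S, OutputsWithin P w O zeroCoins x out t)] :
    successProb P w O x S t =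
      if ∃ out ∈ S, OutputsWithin P w O zeroCoins x out t then 1 else 0 := by
  split_ifs with h
  · exact (successProb_eq_one_iff_of_isDeterministic_holds hP w O x S t).2 h
  · rcases successProb_eq_of_isDeterministic_holds hP w O x S t with h0 | h1
    · exact h0
    · exact absurd ((successProb_eq_one_iff_of_isDeterministic_holds hP w O x S t).1 h1) h


/-! ## Runs read only a prefix of the coin stream; the success probability is monotone in time

A run of at most `t` steps executes at most `t` `rand` instructions, so it reads only the coins
at positions `< t`; hence extending both the time bound and the coin vector can only enlarge the
success event, and `successProb P w O x S t` is monotone in `t` (each successful coin vector of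
length `t` has `(2 ^ w) ^ (t' - t)` successful extensions of length `t'`). This is the
randomised counterpart of `OutputsWithin.mono`, used for the monotonicity of the randomised
running-time predicates of `Literature.Computability.Cryptography.FGComplexity`. -/

/-- One step advances the coin position by at most one. [folklore] -/
theorem step_coinPos_le {P : Program} {w : ℕ} {O : List ℕ → List ℕ} {ρ : ℕ → ℕ} {c c' : Cfg}
    (h : step P w O ρ c = some c') : c'.coinPos ≤ c.coinPos + 1 := by
  unfold step at h
  cases hpc : c.pc with
  | none => simp [hpc] at h
  | some i =>
    simp only [hpc] at h
    cases hI : P[i]? with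
    | none =>
      simp only [hI, Option.some.injEq] at h
      subst h
      exact Nat.le_succ _
    | some I =>
      simp only [hI] at h
      cases I <;> (simp only [Option.some.injEq] at h; subst h) <;> simp

/-- One step depends on the coin stream only through the coin at the current coin position. [folklore] -/
theorem step_congr_coinPos {P : Program} (w : ℕ) (O : List ℕ → List ℕ) {ρ ρ' : ℕ → ℕ} (c : Cfg)
    (h : ρ c.coinPos = ρ' c.coinPos) : step P w O ρ c = step P w O ρ' c := by
  unfold step
  cases c.pc with
  | none => rfl
  | some i =>
    simp only
    cases P[i]? with
    | none => rfl
    | some I =>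
      cases I with
      | rand dst => rw [h]
      | _ => rfl

/-- **Runs read only a prefix of the coins.** If two coin streams agree below `t`, then for every
`n ≤ t` the `n`-fold iterates of the step function from the initial configuration agree, and a
configuration reached after `n` steps has consumed at most `n` coins. [folklore] -/
theorem iterate_step_congr_of_agree (P : Program) (w : ℕ) (O : List ℕ → List ℕ) {ρ ρ' : ℕ → ℕ}
    (x : List ℕ) {t : ℕ} (hagree : ∀ i < t, ρ i = ρ' i) :
    ∀ n ≤ t, (flip bind (step P w O ρ))^[n] (some (init w x)) =
        (flip bind (step P w O ρ'))^[n] (some (init w x)) ∧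
      ∀ c, (flip bind (step P w O ρ))^[n] (some (init w x)) = some c → c.coinPos ≤ n := by
  intro n
  induction n with
  | zero =>
    intro _
    refine ⟨rfl, fun c hc => ?_⟩
    simp only [Function.iterate_zero, id_eq, Option.some.injEq] at hc
    subst hc
    simp
  | succ n ih =>
    intro hn
    obtain ⟨heq, hpos⟩ := ih (Nat.le_of_succ_le hn)
    rw [Function.iterate_succ_apply', Function.iterate_succ_apply', ← heq]
    cases hr : (flip bind (step P w O ρ))^[n] (some (init w x)) with
    | none => exact ⟨rfl, fun c hc => absurd hc.symm (by rw [flip_bind_none]; exact Option.some_ne_none c)⟩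
    | some c =>
      have hlt : c.coinPos < t := lt_of_le_of_lt (hpos c hr) hn
      refine ⟨?_, fun c' hc' => ?_⟩
      · simp only [flip_bind_some]
        exact step_congr_coinPos w O c (hagree _ hlt)
      · simp only [flip_bind_some] at hc'
        exact (step_coinPos_le hc').trans (Nat.succ_le_succ (hpos c hr))

/-- `OutputsWithin P w O ρ x out t` depends on the coin stream `ρ` only below `t`. [folklore] -/
theorem OutputsWithin.congr_coins {P : Program} {w : ℕ} {O : List ℕ → List ℕ} {ρ ρ' : ℕ → ℕ}
    {x out : List ℕ} {t : ℕ} (h : OutputsWithin P w O ρ x out t) (hagree : ∀ i < t, ρ i = ρ' i) :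
    OutputsWithin P w O ρ' x out t := by
  obtain ⟨c, ⟨e⟩, hc, hout⟩ := h
  obtain ⟨heq, -⟩ := iterate_step_congr_of_agree P w O x hagree e.steps e.steps_le_m
  refine ⟨c, ⟨⟨⟨e.steps, ?_⟩, e.steps_le_m⟩⟩, ?_, hout⟩
  · rw [← heq]
    exact e.evals_in_steps
  · rwa [step_eq_none_iff] at hc ⊢

/-- `HaltsWithin P w O ρ x t c` depends on the coin stream `ρ` only below `t`. [folklore] -/
theorem HaltsWithin.congr_coins {P : Program} {w : ℕ} {O : List ℕ → List ℕ} {ρ ρ' : ℕ → ℕ}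
    {x : List ℕ} {t : ℕ} {c : Cfg} (h : HaltsWithin P w O ρ x t c) (hagree : ∀ i < t, ρ i = ρ' i) :
    HaltsWithin P w O ρ' x t c := by
  obtain ⟨⟨e⟩, hc⟩ := h
  obtain ⟨heq, -⟩ := iterate_step_congr_of_agree P w O x hagree e.steps e.steps_le_m
  refine ⟨⟨⟨⟨e.steps, ?_⟩, e.steps_le_m⟩⟩, ?_⟩
  · rw [← heq]
    exact e.evals_in_steps
  · rwa [step_eq_none_iff] at hc ⊢

/-- Counting extensions: if a property of coin vectors of length `t + m` follows from a property
of their length-`t` prefix, then the long vectors with the property are at least `|F| ^ m` times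
as many as the short ones. [folklore] -/
theorem card_filter_mul_card_pow_le {F : Type*} [Fintype F] (t m : ℕ) (p : (Fin t → F) → Prop)
    (q : (Fin (t + m) → F) → Prop) [DecidablePred p] [DecidablePred q]
    (hpq : ∀ ρ : Fin (t + m) → F, p (fun i => ρ (Fin.castAdd m i)) → q ρ) :
    (Finset.univ.filter p).card * Fintype.card F ^ m ≤ (Finset.univ.filter q).card := by
  classical
  calc (Finset.univ.filter p).card * Fintype.card F ^ m
      = ((Finset.univ.filter p) ×ˢ (Finset.univ : Finset (Fin m → F))).card := by
        rw [Finset.card_product, Finset.card_univ, Fintype.card_fun, Fintype.card_fin]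
    _ = (((Finset.univ.filter p) ×ˢ (Finset.univ : Finset (Fin m → F))).map
          (Fin.appendEquiv t m).toEmbedding).card := (Finset.card_map _).symm
    _ ≤ (Finset.univ.filter q).card := by
        refine Finset.card_le_card fun ρ hρ => ?_
        rw [Finset.mem_map_equiv, Finset.mem_product] at hρ
        have hp := (Finset.mem_filter.1 hρ.1).2
        simp only [Fin.appendEquiv_symm_apply] at hp
        exact Finset.mem_filter.2 ⟨Finset.mem_univ _, hpq ρ hp⟩

/-- **Monotonicity of the success probability in the time bound.** Extending the time bound from
`t` to `t' ≥ t` can only increase `successProb P w O x S ·`: a coin vector of length `t` on which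
`P` outputs into `S` within `t` steps extends in `(2 ^ w) ^ (t' - t)` ways to a coin vector of
length `t'` on which it does so within `t'` steps (`OutputsWithin.congr_coins`,
`OutputsWithin.mono`). V. Vassilevska Williams ICM 2018, §2 (randomised word RAM; implicit in
"running time `t(n)`"). [folklore] -/
theorem successProb_mono_steps (P : Program) (w : ℕ) (O : List ℕ → List ℕ) (x : List ℕ)
    (S : Set (List ℕ)) {t t' : ℕ} (h : t ≤ t') :
    successProb P w O x S t ≤ successProb P w O x S t' := by
  classical
  obtain ⟨m, rfl⟩ := Nat.exists_eq_add_of_le h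
  have key : ∀ ρ : Fin (t + m) → Fin (2 ^ w),
      (∃ out ∈ S, OutputsWithin P w O (coinStream fun i => ρ (Fin.castAdd m i)) x out t) →
        ∃ out ∈ S, OutputsWithin P w O (coinStream ρ) x out (t + m) := by
    rintro ρ ⟨out, hout, hrun⟩
    refine ⟨out, hout, (hrun.congr_coins fun i hi => ?_).mono (Nat.le_add_right t m)⟩
    simp [coinStream, hi, Nat.lt_add_right m hi]
  have hcard := card_filter_mul_card_pow_le t m
    (fun ρ : Fin t → Fin (2 ^ w) => ∃ out ∈ S, OutputsWithin P w O (coinStream ρ) x out t)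
    (fun ρ : Fin (t + m) → Fin (2 ^ w) => ∃ out ∈ S, OutputsWithin P w O (coinStream ρ) x out (t + m))
    key
  rw [Fintype.card_fin] at hcard
  have hcardR : ((Finset.univ.filter fun ρ : Fin t → Fin (2 ^ w) =>
        ∃ out ∈ S, OutputsWithin P w O (coinStream ρ) x out t).card : ℝ) * ((2 : ℝ) ^ w) ^ m ≤
      ((Finset.univ.filter fun ρ : Fin (t + m) → Fin (2 ^ w) =>
        ∃ out ∈ S, OutputsWithin P w O (coinStream ρ) x out (t + m)).card : ℝ) := by
    exact_mod_cast hcard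
  have h2 : (0 : ℝ) < (2 : ℝ) ^ w := pow_pos two_pos _
  unfold successProb
  rw [div_le_div_iff₀ (pow_pos h2 _) (pow_pos h2 _), pow_add,
    mul_comm (((2 : ℝ) ^ w) ^ t) (((2 : ℝ) ^ w) ^ m), ← mul_assoc]
  exact mul_le_mul_of_nonneg_right hcardR (pow_nonneg (pow_nonneg zero_le_two _) _)

end Literature.Computability.Cryptography.WordRAM
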